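import Literature.MathematicalPhysics.StatisticalMechanics.ComplexSpinFluctuationAntipodalBound
import Literature.Probability.LatticeModels.LatticeGreenFourCertificate
import Literature.Probability.LatticeModels.LatticeGreenFiveSevenCertificate
import HarnessLib

/-!
# Chiral long-range order at strong coupling in four and more dimensions, unconditionally:
# Salmhofer–Seiler's Cor. 4.9 / (A.60) for `U(1)`, `U(2)`, `U(3)` (`ν ≥ 4`), `U(4)` (`ν ≥ 5`),
# `U(5)` (`ν ≥ 7`) (CMP 139 (1991))

Seventeenth file of the Salmhofer–Seiler series; theorems only.  The series proves Thm. 4.8 and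
Cor. 4.9 of Salmhofer–Seiler in their uniform finite-volume form ("`2S(ν)K(N)/N < 1` ⇒ chiral
long-range order at `m = 0` on all large even tori", `ComplexSpinFluctuationBound`), the bounds
`S(ν) ≤ νR(ν) - 3/4` (printed, Remark A.5) and `S(ν) ≤ νR(ν) - 1 + 1/(2√(2ν))`
(`ComplexSpinFluctuationAntipodalBound`), and their monotonicity in `ν` (Proposition A.6).  What the
printed Cor. 4.9 ("`N ∈ {1,…,4}`, `ν ≥ 4`") needs beyond this is NUMERICAL: the value of the infrared
constant `R(4) = latticeGreen 0` ("`R(4) ≤ 0.3100`", p. 430, computer-assisted in print), so far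
carried as the hypothesis `latticeGreen (0 : Site 4) < 5/16` of
`u1∕u2_chiralLRO_of_latticeGreen_four_lt` (`ComplexSpinChiralLROMonotone`) and
`u3_chiralLRO_of_latticeGreen_four_lt'`.  `LatticeGreenFourCertificate.latticeGreen_four_zero_lt`
proves that hypothesis by kernel evaluation (`0.3086 ≤ R(4) ≤ 0.3104`).  Hence, UNCONDITIONALLY:

* `u1_chiralLRO` — **strongly coupled (`β = 0`) lattice QED with massless staggered fermions, in its
  complex-spin form, has chiral long-range order in every dimension `ν ≥ 4`**: there are `c > 0`, `L₀`
  with `|Λ|⁻¹ ∑_x ⟨σ_0 σ_x⟩_Λ ≥ c` on every even torus `(ℤ/Lℤ)^ν`, `L ≥ L₀` ((A.60): "`S(4) ≤ 4R(4) -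
  3/4 < 1/2`, so that already this bound suffices to prove symmetry breaking for QED");
* `u2_chiralLRO` — the same for the `U(2)` theory, `ν ≥ 4` ((A.60));
* `u3_chiralLRO` — the same for the `U(3)` theory, `ν ≥ 4` (Cor. 4.9, `N = 3`; here through the
  antipodal bound `S(ν) ≤ 4R(4) - 1 + 1/(4√2) < 0.43 < 0.45 = 3/(2K(3))` instead of the printed
  numerics `S(4) < 0.35`).

In the same way `LatticeGreenFiveSevenCertificate` certifies the other two printed inputs of p. 430,
`R(5) < 6/25` ("`R(5) ≤ 0.2313`", here `5R(5) ≤ 1.1816`) and `R(7) < 369/2324` ("`R(7) ≤ 0.1564`",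
here `7R(7) ≤ 1.0984`), whence, again unconditionally:

* `u4_chiralLRO` — the `U(4)` theory has chiral long-range order at `m = 0` in every dimension
  `ν ≥ 5` (Cor. 4.9, `N = 4`, through `S(ν) ≤ 5R(5) - 1 + 1/(2√10) < 0.34 < 30/83 = 4/(2K(4))`);
* `u5_chiralLRO` — the `U(5)` theory (with the CORRECTED constant `K(5) = 12227/1330`, erratum E7 of
  `ComplexSpinChiralLRO`) has chiral long-range order at `m = 0` in every dimension `ν ≥ 7`;
* `fluctS_five_lt`, `fluctS_seven_lt` — the numerical by-products `S(5) < 0.34`, `S(7) < 0.233`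
  (p. 430 prints `S(5) ≤ 0.25`, `S(6) ≤ 0.20` and no value for `S(7)`).

NOT reached this way (honest): the printed `U(4)` case at `ν = 4` (it needs `S(4) < 0.3614`, i.e. the
`S`-column of Prop. 4.2 (4) — a quadrature with a sign-changing integrand, true value `S(4) ≈ 0.333` —
not only `R(4)`), and `U(5)` at `ν = 5, 6`.  Honest framing: these are statements about
Salmhofer–Seiler's `β = 0` complex spin systems (the bosonised `U(N)` one-link integrals, §2 of the
paper, whose identification with the gauge theory — Rossi–Wolff — is not formalised in the tree) on
even tori at `m = 0`, uniform in the volume; nothing about `β > 0`, the continuum limit, `SU(N)`, a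
mass gap or the summit's `QCD` conjunct.

## References

* M. Salmhofer, E. Seiler, Commun. Math. Phys. 139 (1991) 395–432: Thm. 4.8, Cor. 4.9, Prop. 4.2,
  (A.60)–(A.61) and p. 430. [SalmhoferSeiler1991]
-/

noncomputable section

open Literature.Probability.LatticeModels

namespace Literature.MathematicalPhysics.StatisticalMechanics

namespace ComplexSpin

variable {ν : ℕ}

/-- **Salmhofer–Seiler (A.60) for `U(1)`, unconditionally**: for strongly coupled lattice QED with
massless staggered fermions in its complex-spin form (`N = 1`, `K(1) = 1`), in every dimension `ν ≥ 4`
there are `c > 0` and `L₀` such that `|Λ|⁻¹ ∑_x ⟨σ_0 σ_x⟩_Λ ≥ c` on every even torus `(ℤ/Lℤ)^ν` with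
`L ≥ L₀` — chiral long-range order at `m = 0`, uniform in the volume.  The printed computer-assisted
input `R(4) ≤ 0.3100 < 5/16` is `LatticeGreenFourCertificate.latticeGreen_four_zero_lt`.
[cite: SalmhoferSeiler1991, (A.60) p. 430 with Cor. 4.9 and Proposition A.6] -/
theorem u1_chiralLRO (hν : 4 ≤ ν) :
    ∃ c : ℝ, 0 < c ∧ ∃ L₀ : ℕ, ∀ (L : ℕ) [NeZero L], Even L → L₀ ≤ L →
      c ≤ (Fintype.card (TorusSite ν L) : ℝ)⁻¹ *
          ∑ x : TorusSite ν L, expect 1 0 (uNBondCoeff 1)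
            (MvPolynomial.X (0 : TorusSite ν L) * MvPolynomial.X x) :=
  u1_chiralLRO_of_latticeGreen_four_lt latticeGreen_four_zero_lt hν

/-- **Salmhofer–Seiler (A.60) for `U(2)`, unconditionally** (`K(2) = 2`): chiral long-range order at
`m = 0` in every dimension `ν ≥ 4`, uniform in the even volume.
[cite: SalmhoferSeiler1991, (A.60) p. 430 with Cor. 4.9 and Proposition A.6] -/
theorem u2_chiralLRO (hν : 4 ≤ ν) :
    ∃ c : ℝ, 0 < c ∧ ∃ L₀ : ℕ, ∀ (L : ℕ) [NeZero L], Even L → L₀ ≤ L →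
      c ≤ (Fintype.card (TorusSite ν L) : ℝ)⁻¹ *
          ∑ x : TorusSite ν L, expect 2 0 (uNBondCoeff 2)
            (MvPolynomial.X (0 : TorusSite ν L) * MvPolynomial.X x) :=
  u2_chiralLRO_of_latticeGreen_four_lt latticeGreen_four_zero_lt hν

/-- **Salmhofer–Seiler Cor. 4.9 for `U(3)`, unconditionally** (`K(3) = 10/3`): chiral long-range
order at `m = 0` in every dimension `ν ≥ 4`, uniform in the even volume — the three-colour,
four-dimensional case of the printed "`N ∈ {1,…,4}`, `ν ≥ 4`", reached through the antipodal bound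
`S(ν) ≤ 4R(4) - 1 + 1/(4√2)` and the kernel-certified `R(4) < 5/16` (the print uses the numerics
`S(4) < 0.35` of Prop. 4.2 (4) instead). [cite: SalmhoferSeiler1991, Cor. 4.9 with Prop. 4.2 and Proposition A.6] -/
theorem u3_chiralLRO (hν : 4 ≤ ν) :
    ∃ c : ℝ, 0 < c ∧ ∃ L₀ : ℕ, ∀ (L : ℕ) [NeZero L], Even L → L₀ ≤ L →
      c ≤ (Fintype.card (TorusSite ν L) : ℝ)⁻¹ *
          ∑ x : TorusSite ν L, expect 3 0 (uNBondCoeff 3)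
            (MvPolynomial.X (0 : TorusSite ν L) * MvPolynomial.X x) :=
  u3_chiralLRO_of_latticeGreen_four_lt' latticeGreen_four_zero_lt hν

/-- **The sharpened constant at `ν = 4`, numerically**: `S(4) < 0.419` (`S(4) ≤ 4R(4) - 1 + 1/(4√2)`
with `4R(4) ≤ 1.2413`; the printed computer-assisted value is `S(4) < 0.35`, true value `≈ 0.333`).
[cite: SalmhoferSeiler1991, Prop. 4.2 (4) (`S(4) ≤ 0.34`) and (A.60)] -/
theorem fluctS_four_lt : fluctS 4 < 419 / 1000 := by
  have h := fluctS_le_antipodal (ν := 4) (by norm_num)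
  have hR := four_mul_latticeGreen_four_zero_le
  have h8 : 1 / (2 * Real.sqrt (2 * (4 : ℕ))) ≤ (177 / 1000 : ℝ) := by
    have hb : (2.8249 : ℝ) ≤ Real.sqrt (2 * (4 : ℕ)) := Real.le_sqrt_of_sq_le (by norm_num)
    rw [div_le_iff₀ (by positivity)]
    nlinarith
  push_cast at h hR h8
  linarith

/-- **Salmhofer–Seiler Cor. 4.9 for `U(4)` in dimensions `ν ≥ 5`, unconditionally** (`K(4) = 83/15`):
chiral long-range order at `m = 0`, uniform in the even volume, through the antipodal bound
`S(ν) ≤ 5R(5) - 1 + 1/(2√10)` (Prop. A.6 monotonicity for `ν ≥ 5`) and the kernel-certified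
`R(5) < 6/25` of `LatticeGreenFiveSevenCertificate` (print: "`R(5) ≤ 0.2313`", `S(5) ≤ 0.25`).  The
printed case `ν = 4` is NOT covered here (it needs `S(4) < 0.3614`).
[cite: SalmhoferSeiler1991, Cor. 4.9 with Prop. 4.2 (4), Proposition A.6 and p. 430] -/
theorem u4_chiralLRO (hν : 5 ≤ ν) :
    ∃ c : ℝ, 0 < c ∧ ∃ L₀ : ℕ, ∀ (L : ℕ) [NeZero L], Even L → L₀ ≤ L →
      c ≤ (Fintype.card (TorusSite ν L) : ℝ)⁻¹ *
          ∑ x : TorusSite ν L, expect 4 0 (uNBondCoeff 4)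
            (MvPolynomial.X (0 : TorusSite ν L) * MvPolynomial.X x) :=
  u4_chiralLRO_of_latticeGreen_five_lt' latticeGreen_five_zero_lt hν

/-- **Salmhofer–Seiler Cor. 4.9 for `U(5)` in dimensions `ν ≥ 7`, unconditionally**, with the
CORRECTED constant `K(5) = 12227/1330` (the printed "`K(5) < 7.4`" rests on a misprinted `w₅`,
erratum E7 of `ComplexSpinChiralLRO`): chiral long-range order at `m = 0`, uniform in the even
volume, through `S(ν) ≤ 7R(7) - 1 + 1/(2√14)` and the kernel-certified `R(7) < 369/2324` (print:
"`R(7) ≤ 0.1564`").  The dimensions `ν = 5, 6` of the printed claim are NOT covered here.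
[cite: SalmhoferSeiler1991, Cor. 4.9 with (4.27)–(4.29), Prop. 4.2 (4), Proposition A.6 and p. 430] -/
theorem u5_chiralLRO (hν : 7 ≤ ν) :
    ∃ c : ℝ, 0 < c ∧ ∃ L₀ : ℕ, ∀ (L : ℕ) [NeZero L], Even L → L₀ ≤ L →
      c ≤ (Fintype.card (TorusSite ν L) : ℝ)⁻¹ *
          ∑ x : TorusSite ν L, expect 5 0 (uNBondCoeff 5)
            (MvPolynomial.X (0 : TorusSite ν L) * MvPolynomial.X x) :=
  u5_chiralLRO_of_latticeGreen_seven_lt latticeGreen_seven_zero_lt hν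

/-- **`S(5) < 0.34`** (`S(5) ≤ 5R(5) - 1 + 1/(2√10)` with `5R(5) ≤ 1.1816`; printed computer-assisted
value `S(5) ≤ 0.25`). [cite: SalmhoferSeiler1991, Prop. 4.2 (4) and p. 430] -/
theorem fluctS_five_lt : fluctS 5 < 34 / 100 := by
  have h := fluctS_le_antipodal (ν := 5) (by norm_num)
  have hR := five_mul_latticeGreen_five_zero_le
  have h8 : 1 / (2 * Real.sqrt (2 * (5 : ℕ))) ≤ (1582 / 10000 : ℝ) := by
    have hb : (3.1622 : ℝ) ≤ Real.sqrt (2 * (5 : ℕ)) := Real.le_sqrt_of_sq_le (by norm_num)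
    rw [div_le_iff₀ (by positivity)]
    nlinarith
  push_cast at h hR h8
  linarith

/-- **`S(7) < 0.233`** (`S(7) ≤ 7R(7) - 1 + 1/(2√14)` with `7R(7) ≤ 1.0984`; p. 430 prints
`R(7) ≤ 0.1564` and `S`-values only up to `S(6) ≤ 0.20`). [cite: SalmhoferSeiler1991, Prop. 4.2 (4) and p. 430] -/
theorem fluctS_seven_lt : fluctS 7 < 233 / 1000 := by
  have h := fluctS_le_antipodal (ν := 7) (by norm_num)
  have hR := seven_mul_latticeGreen_seven_zero_le
  have h8 : 1 / (2 * Real.sqrt (2 * (7 : ℕ))) ≤ (1337 / 10000 : ℝ) := by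
    have hb : (3.7416 : ℝ) ≤ Real.sqrt (2 * (7 : ℕ)) := Real.le_sqrt_of_sq_le (by norm_num)
    rw [div_le_iff₀ (by positivity)]
    nlinarith
  push_cast at h hR h8
  linarith

end ComplexSpin

end Literature.MathematicalPhysics.StatisticalMechanics

end
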